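import Mathlib
import HarnessLib
import Summits.ValiantsHypothesis.ValiantsHypothesis.Theorems.LacunarySymmetroidMatrixDescartesProductPlusOneLateSwitching

/-!
# ValiantsHypothesis / LacunarySymmetroid — crux `MatrixDescartes` (stmt-ValiantsHypothesis-18050, V1),
# LINE (A) «product_plus_one», floor `OneChangeFloorK3`: the WEAK-MIDDLE-LETTER SECTOR (a coefficient sector, linear at EVERY ratio)

✓ `…ProductPlusOneLateSwitching` proved `Z₊(eulerNumerator d a 0) ≤ 2m + 1` at every support ratio for no-dip companies whose incoherent rows
are LATE-SWITCHING (unswitched wherever not top-dominated) — a pointwise hypothesis.  This file turns it into a COEFFICIENT condition: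
for an incoherent no-dip row `f = a₀ x^{d₀} + a₁ x^{d₁} + a₂ x^{d₂}` (`a₀a₁ < 0`, `a₀a₂ < 0`; `p = d₁−d₀`, `q = d₂−d₀`) the WEAK-MIDDLE-LETTER
inequality

  `((q−2p)·a₁a₂)^{q−p} · ((q−3p)·a₁a₂)^p ≤ (p·a₂²)^p · (−p·a₀a₂)^{q−p}`   (≡ `(q−2p)^{q−p}(q−3p)^p·|a₁|^q ≤ p^q·|a₀|^{q−p}·|a₂|^p`)

forces late switching (`unswitched_of_weakMiddle`: below the balance point `|a₁|x^p + |a₂|x^q < |a₁|x^p·(q−2p)/p ≤ |a₀|`).  Hence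

* ★★ `eulerBound_weakMiddle` — a NO-DIP company on ANY support `d 0 < d 1 < d 2`, bottom coupling, whose incoherent rows all have a weak
  middle letter ⇒ `Z₊(eulerNumerator d a 0) ≤ 2m + 1`; `weakMiddle_sector_class` — members `≤ 2m + 2`.

This is a genuine COEFFICIENT SECTOR of the floor at every ratio (the tame sector is a SUPPORT sector, ratio `≤ 4`; here the ratio is free and
the middle letters are bounded against the geometric mean `|a₀|^{(q−p)/q}|a₂|^{p/q}`); at ratio `q ≤ 3p` the condition is empty.
HONEST FRAMING: a sector of the research floor; NOT `OneChangeFloorK3` / `stub_eulerBoundK3` / `stub_classRowK3` / `stub_polyLaw` /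
`MatrixDescartes`; `VP ≠ VNP` is NOT proved.  No definitions, no named facts; Mathlib + the lane files.
-/

set_option linter.dupNamespace false

namespace Summit.ValiantsHypothesis.ValiantsHypothesis.Theorems.LacunarySymmetroidMatrixDescartes

namespace ProductPlusOne

open Polynomial Finset
open scoped BigOperators

/-- **Weak middle letter ⇒ late switching** (normalised chart `g = a + b x^{e+1} + c x^{e+k+2}`, `p = e+1`, `q = e+k+2`): for an
incoherent no-dip row (`a c < 0`, `a b < 0`) with `((q−2p)·bc)^{k+1}·((q−3p)·bc)^{e+1} ≤ (p·c²)^{e+1}·(−p·ac)^{k+1}`, at every `x > 0`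
below the balance point (`p·c²·x^{k+1} < (q−3p)·bc`) the row is unswitched: `c·g(x) < 0`. [this file's lemma] -/
theorem unswitched_of_weakMiddle (a b c : ℝ) (e k : ℕ) (hac : a * c < 0) (hab : a * b < 0)
    (hW : (((e + k + 2 : ℝ) - 2 * (e + 1 : ℝ)) * (b * c)) ^ (k + 1) * ((((e + k + 2 : ℝ) - 3 * (e + 1 : ℝ)) * (b * c))) ^ (e + 1)
      ≤ ((e + 1 : ℝ) * c ^ 2) ^ (e + 1) * (-((e + 1 : ℝ) * (a * c))) ^ (k + 1))
    {x : ℝ} (hx : 0 < x) (hlt : (e + 1 : ℝ) * c ^ 2 * x ^ (k + 1) < ((e + k + 2 : ℝ) - 3 * (e + 1 : ℝ)) * (b * c)) :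
    c * (a + b * x ^ (e + 1) + c * x ^ (e + k + 2)) < 0 := by
  have hc : c ≠ 0 := by
    rintro rfl
    rw [mul_zero] at hac
    exact lt_irrefl 0 hac
  have hbc : 0 < b * c := by
    have h1 : 0 < (a * b) * (a * c) := mul_pos_of_neg_of_neg hab hac
    have h2 : (a * b) * (a * c) = a ^ 2 * (b * c) := by ring
    rw [h2] at h1
    exact pos_of_mul_pos_right h1 (sq_nonneg a)
  have hq3 : 0 < ((e + k + 2 : ℝ) - 3 * (e + 1 : ℝ)) := by
    have h1 : 0 < (e + 1 : ℝ) * c ^ 2 * x ^ (k + 1) := by positivity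
    exact pos_of_mul_pos_left (h1.trans hlt) hbc.le
  have hq2 : 0 < ((e + k + 2 : ℝ) - 2 * (e + 1 : ℝ)) := by linarith
  have hpac : 0 < -((e + 1 : ℝ) * (a * c)) := by
    have := mul_neg_of_pos_of_neg (show (0 : ℝ) < (e + 1 : ℝ) by positivity) hac
    linarith
  -- the key bound `(q − 2p)·bc·x^p ≤ −p·ac`
  have hkey : ((e + k + 2 : ℝ) - 2 * (e + 1 : ℝ)) * (b * c) * x ^ (e + 1) ≤ -((e + 1 : ℝ) * (a * c)) := by
    by_contra hcon
    push Not at hcon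
    have hA := pow_lt_pow_left₀ hcon hpac.le (n := k + 1) (Nat.succ_ne_zero k)
    have hB := pow_lt_pow_left₀ hlt (by positivity : (0 : ℝ) ≤ (e + 1 : ℝ) * c ^ 2 * x ^ (k + 1)) (n := e + 1)
      (Nat.succ_ne_zero e)
    have eA : (((e + k + 2 : ℝ) - 2 * (e + 1 : ℝ)) * (b * c) * x ^ (e + 1)) ^ (k + 1)
        = (((e + k + 2 : ℝ) - 2 * (e + 1 : ℝ)) * (b * c)) ^ (k + 1) * x ^ ((e + 1) * (k + 1)) := by
      rw [mul_pow, ← pow_mul]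
    have eB : ((e + 1 : ℝ) * c ^ 2 * x ^ (k + 1)) ^ (e + 1) = ((e + 1 : ℝ) * c ^ 2) ^ (e + 1) * x ^ ((e + 1) * (k + 1)) := by
      rw [mul_pow, ← pow_mul, mul_comm (k + 1)]
    rw [eA] at hA
    rw [eB] at hB
    have hT : 0 < x ^ ((e + 1) * (k + 1)) := by positivity
    have hP : 0 < ((e + 1 : ℝ) * c ^ 2) ^ (e + 1) := by positivity
    have hQ : 0 < (((e + k + 2 : ℝ) - 2 * (e + 1 : ℝ)) * (b * c)) ^ (k + 1) := pow_pos (mul_pos hq2 hbc) _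
    have h1 : (-((e + 1 : ℝ) * (a * c))) ^ (k + 1) * ((e + 1 : ℝ) * c ^ 2) ^ (e + 1)
        < (((e + k + 2 : ℝ) - 2 * (e + 1 : ℝ)) * (b * c)) ^ (k + 1) * x ^ ((e + 1) * (k + 1)) * ((e + 1 : ℝ) * c ^ 2) ^ (e + 1) :=
      mul_lt_mul_of_pos_right hA hP
    have h2 : (((e + k + 2 : ℝ) - 2 * (e + 1 : ℝ)) * (b * c)) ^ (k + 1) * (((e + 1 : ℝ) * c ^ 2) ^ (e + 1) * x ^ ((e + 1) * (k + 1)))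
        < (((e + k + 2 : ℝ) - 2 * (e + 1 : ℝ)) * (b * c)) ^ (k + 1) * (((e + k + 2 : ℝ) - 3 * (e + 1 : ℝ)) * (b * c)) ^ (e + 1) :=
      mul_lt_mul_of_pos_left hB hQ
    nlinarith
  -- `p·(c·g(x)) = p·ac + p·bc·x^p + (p·c²·x^{k+1})·x^p < p·ac + (q−2p)·bc·x^p ≤ 0`
  have hX : 0 < x ^ (e + 1) := pow_pos hx _
  have h3 : (e + 1 : ℝ) * c ^ 2 * x ^ (k + 1) * x ^ (e + 1) < ((e + k + 2 : ℝ) - 3 * (e + 1 : ℝ)) * (b * c) * x ^ (e + 1) :=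
    mul_lt_mul_of_pos_right hlt hX
  have e3 : (e + 1 : ℝ) * (c * (a + b * x ^ (e + 1) + c * x ^ (e + k + 2)))
      = (e + 1 : ℝ) * (a * c) + (e + 1 : ℝ) * (b * c) * x ^ (e + 1) + (e + 1 : ℝ) * c ^ 2 * x ^ (k + 1) * x ^ (e + 1) := by
    ring
  have h4 : (e + 1 : ℝ) * (c * (a + b * x ^ (e + 1) + c * x ^ (e + k + 2))) < 0 := by
    rw [e3]
    nlinarith
  have hp0 : (0 : ℝ) < (e + 1 : ℝ) := by positivity
  by_contra hge
  push Not at hge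
  have := mul_nonneg hp0.le hge
  linarith

/-- ★★ **THE WEAK-MIDDLE-LETTER SECTOR IS LINEAR AT EVERY RATIO.**  `K = 3`, bottom coupling, ANY support `d 0 < d 1 < d 2`, any `m`; a no-dip
company (`a_{j0} a_{j2} < 0`) in which every INCOHERENT row (`a_{j0} a_{j1} < 0`) has a weak middle letter,
`((q−2p)·a_{j1}a_{j2})^{d₂−d₁}·((q−3p)·a_{j1}a_{j2})^{d₁−d₀} ≤ (p·a_{j2}²)^{d₁−d₀}·(−p·a_{j0}a_{j2})^{d₂−d₁}` with `p = d₁−d₀`, `q = d₂−d₀`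
(reals).  Then `Z₊(eulerNumerator d a 0) ≤ 2m + 1`. [this file's theorem] -/
theorem eulerBound_weakMiddle {m : ℕ} (d : Fin 3 → ℕ) (h01 : d 0 < d 1) (h12 : d 1 < d 2)
    (a : Fin m → Fin 3 → ℝ) (hac : ∀ j, a j 0 * a j 2 < 0)
    (hweak : ∀ j, a j 0 * a j 1 < 0 →
      ((((d 2 : ℝ) - d 0) - 2 * ((d 1 : ℝ) - d 0)) * (a j 1 * a j 2)) ^ (d 2 - d 1)
          * ((((d 2 : ℝ) - d 0) - 3 * ((d 1 : ℝ) - d 0)) * (a j 1 * a j 2)) ^ (d 1 - d 0)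
        ≤ (((d 1 : ℝ) - d 0) * a j 2 ^ 2) ^ (d 1 - d 0) * (-(((d 1 : ℝ) - d 0) * (a j 0 * a j 2))) ^ (d 2 - d 1)) :
    ((∑ j, (∑ l, C (a j l * ((d l : ℝ) - d 0)) * X ^ (d l)) * ∏ i ∈ Finset.univ.erase j, (∑ l, C (a i l) * X ^ (d l))
        : ℝ[X]).roots.toFinset.filter (fun t => 0 < t)).card ≤ 2 * m + 1 := by
  obtain ⟨e, he⟩ : ∃ e, d 1 = d 0 + e + 1 := ⟨d 1 - d 0 - 1, by omega⟩
  obtain ⟨k, hk⟩ : ∃ k, d 2 = d 0 + e + k + 2 := ⟨d 2 - d 1 - 1, by omega⟩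
  have hk1 : d 2 - d 1 = k + 1 := by omega
  have he1 : d 1 - d 0 = e + 1 := by omega
  have hp : ((d 1 : ℝ) - d 0) = (e + 1 : ℝ) := by rw [he]; push_cast; ring
  have hq : ((d 2 : ℝ) - d 0) = (e + k + 2 : ℝ) := by rw [hk]; push_cast; ring
  refine eulerBound_lateSwitching d h01 h12 a hac (fun j hab x hx hlt => ?_)
  have hW := hweak j hab
  rw [hp, hq, hk1, he1] at hW
  rw [hp, hq, hk1] at hlt
  have h := unswitched_of_weakMiddle (a j 0) (a j 1) (a j 2) e k (hac j) hab hW hx hlt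
  rw [eval_row_eq_pow_mul d e k he hk (a j) x, mul_left_comm]
  exact mul_neg_of_pos_of_neg (pow_pos hx _) h

/-- **The weak-middle-letter sector in MEMBER currency:** every member `c·X^{m d 0} + ∏_j f_j` has at most `2m + 2` positive zeros. [this file's theorem] -/
theorem weakMiddle_sector_class {m : ℕ} (d : Fin 3 → ℕ) (h01 : d 0 < d 1) (h12 : d 1 < d 2)
    (a : Fin m → Fin 3 → ℝ) (hac : ∀ j, a j 0 * a j 2 < 0)
    (hweak : ∀ j, a j 0 * a j 1 < 0 →
      ((((d 2 : ℝ) - d 0) - 2 * ((d 1 : ℝ) - d 0)) * (a j 1 * a j 2)) ^ (d 2 - d 1)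
          * ((((d 2 : ℝ) - d 0) - 3 * ((d 1 : ℝ) - d 0)) * (a j 1 * a j 2)) ^ (d 1 - d 0)
        ≤ (((d 1 : ℝ) - d 0) * a j 2 ^ 2) ^ (d 1 - d 0) * (-(((d 1 : ℝ) - d 0) * (a j 0 * a j 2))) ^ (d 2 - d 1)) (c : ℝ) :
    ((C c * X ^ (m * d 0) + ∏ j, (∑ l, C (a j l) * X ^ (d l)) : ℝ[X]).roots.toFinset.filter (fun t => 0 < t)).card
      ≤ 2 * m + 2 := by
  have h1 := card_pos_roots_class_le_euler d a 0 c
  have h2 := eulerBound_weakMiddle d h01 h12 a hac hweak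
  omega

end ProductPlusOne

end Summit.ValiantsHypothesis.ValiantsHypothesis.Theorems.LacunarySymmetroidMatrixDescartes
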